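import Summits.CriticalPhenomena.SAWScalingLimit.Theorems.SAWTotalPositivityCriticalBubbleBoundJoinDefs
import Summits.CriticalPhenomena.SAWScalingLimit.Theorems.SAWTotalPositivityCriticalBubbleBoundDockingEntropyZero

/-!
# The two arcs of a lex-rooted polygon cross every global join plaquette
(line `docking-census-joining`, stubs `gjoins_arcs`, `rootEdge_ne_of_isJoinPlaq`)

Crux `stmt-CriticalPhenomena-7117`
(`Summit.CriticalPhenomena.SAWScalingLimit.Theses.SAWTotalPositivity.CriticalBubbleBound`), line
`docking-census-joining`, JOIN-MASS programme (lead c6), registered stubs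

* `rootEdge_ne_of_isJoinPlaq` — the root edge `{0, e₀}` of a lex-rooted polygon `P(χ)` (`χ ∈ lexRooted n`,
  `n ≥ 2`) is never a horizontal side of a join plaquette of `P(χ)`: the lower side `{q, q+e₀}` equal to
  the root edge forces `q = 0`, but the root's north edge `{0, e₁}` IS an edge of `P(χ)` (the second
  vertex of a lex-rooted walk is `e₁`), contradicting the join-plaquette condition; the upper side
  `{q+e₁, q+e₀+e₁}` equal to the root edge puts the vertex `q` on row `-1`, below the root;
* `gjoins_arcs` — Hammond's Lemma 4.7 with the anchor at the root: for a GLOBAL join plaquette at `q`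
  (the flip splits `P(χ)` into vertex-disjoint polygons `E₁ ∋ 0`, `E₂ ⊇` rightmost column `∋ ES`), each of
  the two arcs `χ[0, esIdx]` (root → `ES`) and `χ[esIdx, n]` (`ES` → `e₀`, closed by the root edge)
  traverses one of the two horizontal sides of the plaquette. CROSSING ARGUMENT: a step edge of `χ` other
  than the two horizontal sides survives the flip, so lies in `E₁ ∪ E₂`, and by vertex-disjointness an
  edge of `E₁ ∪ E₂` with one endpoint on `E₁` lies in `E₁` (resp. `E₂`); so an arc avoiding both sides and
  starting on `E₁` stays on `E₁` — but the head arc runs from `0` (on `E₁`) to `ES` (on `E₂`), and the tail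
  arc runs from `ES` (on `E₂`) to `e₀`, which is on `E₁` because the root edge survives the flip
  (`rootEdge_ne_of_isJoinPlaq`) and contains `0`.

Objects: `…Theorems.SAWTotalPositivityCriticalBubbleBoundJoinDefs` (`lexRooted`, `IsJoinPlaq`, `flipH`,
`IsGlobalJoin`, `gjoins`, `esIdx`, `rightCol`), `…DockingDefs` (`verts`, `pedges`, `rootEdge`, `e₁`).

Sources: A. Hammond, *An upper bound on the number of self-avoiding polygons via joining*, Ann. Probab. 46
(2018), Definition 4.4, Lemma 4.7; N. Madras, G. Slade, *The Self-Avoiding Walk* (1993), Definition 3.2.1.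
Elementary combinatorics ([folklore]).
-/

noncomputable section

open Literature.Probability.LatticeModels
open Literature.Probability.RandomPlanarGeometry Literature.Probability.RandomPlanarGeometry.SAW
open scoped BigOperators
open Summit.CriticalPhenomena.SAWScalingLimit.Theorems.CriticalBubbleBound.Negative (e₀)
open Summit.CriticalPhenomena.SAWScalingLimit.Theorems.CriticalBubbleBound.Docking

namespace Summit.CriticalPhenomena.SAWScalingLimit.Theorems.CriticalBubbleBound.Join

/-! ## Bookkeeping -/

/-- The `i`-th step `{χ i, χ (i+1)}` (`i < n`) is an edge of the rooted polygon `pedges n χ`.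
[cite: MadrasSlade1993, Definition 3.2.1] -/
theorem mk_step_mem_pedges {n : ℕ} (χ : ℕ → Site 2) {i : ℕ} (hi : i < n) :
    s(χ i, χ (i + 1)) ∈ pedges n χ :=
  Finset.mem_insert_of_mem (Finset.mem_image.2 ⟨i, Finset.mem_range.2 hi, rfl⟩)

/-- The second vertex of a lex-rooted walk (`n ≥ 2`) is `e₁`: the root's lattice-neighbours `-e₀`,
`-e₁` are lexicographically negative and `e₀ = χ n` is excluded by self-avoidance. [folklore] -/
theorem apply_one_eq_e₁ {n : ℕ} {χ : ℕ → Site 2} (h : χ ∈ lexRooted n) (hn : 2 ≤ n) : χ 1 = e₁ := by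
  obtain ⟨hsaw, hlex⟩ := mem_lexRooted.1 h
  obtain ⟨h0, hend, hadj, hinj⟩ := Zd.mem_sawFun.1 hsaw
  have h1 := hlex 1 (by omega)
  have ha := hadj 0 (by omega)
  rw [h0] at ha
  rcases adj_cases ha with h' | h' | h' | h'
  · exfalso
    have h1n : (1 : ℕ) = n :=
      hinj (show (1 : ℕ) ∈ {i | i ≤ n} by simp only [Set.mem_setOf_eq]; omega)
        (show n ∈ {i | i ≤ n} from le_refl n) (by rw [h', hend n le_rfl, zero_add])
    omega
  · exfalso
    rw [h'] at h1
    rcases h1 with h1 | ⟨-, h1⟩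
    · simp only [Pi.sub_apply, Pi.zero_apply, e₀_e₁_apply.2.1] at h1
      omega
    · simp only [Pi.sub_apply, Pi.zero_apply, e₀_e₁_apply.1] at h1
      omega
  · rw [h', zero_add]
  · exfalso
    rw [h'] at h1
    rcases h1 with h1 | ⟨h1, -⟩
    · simp only [Pi.sub_apply, Pi.zero_apply, e₀_e₁_apply.2.2.2] at h1
      omega
    · simp only [Pi.sub_apply, Pi.zero_apply, e₀_e₁_apply.2.2.2] at h1
      omega

/-- The root's north edge `{0, e₁}` is an edge of every lex-rooted polygon (`n ≥ 2`). [folklore] -/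
theorem mk_zero_e₁_mem_pedges {n : ℕ} {χ : ℕ → Site 2} (h : χ ∈ lexRooted n) (hn : 2 ≤ n) :
    s((0 : Site 2), e₁) ∈ pedges n χ := by
  have h01 : s(χ 0, χ 1) ∈ pedges n χ := mk_step_mem_pedges χ (show 0 < n by omega)
  rwa [apply_one_eq_e₁ h hn, (Zd.mem_sawFun.1 (lexRooted_subset n h)).1] at h01

/-! ## The root edge is not a side of a join plaquette -/

/-- **Stub `rootEdge_ne_of_isJoinPlaq`.** For a lex-rooted polygon `P(χ)` (`n ≥ 2`) and a join
plaquette at `q` (both horizontal sides in `P(χ)`, neither vertical side), neither horizontal side is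
the root edge `{0, e₀}`: the lower one would force `q = 0` and then the left side `{0, e₁}` is the
root's north edge, an edge of `P(χ)`; the upper one would put the vertex `q` of `P(χ)` on row `-1`.
[folklore] -/
theorem rootEdge_ne_of_isJoinPlaq : ∀ (n : ℕ) (χ : ℕ → Site 2), χ ∈ lexRooted n → 2 ≤ n → ∀ q : Site 2, IsJoinPlaq (pedges n χ) q → s(q, q + e₀) ≠ rootEdge ∧ s(q + e₁, q + e₀ + e₁) ≠ rootEdge := by
  intro n χ hχ hn q hq
  obtain ⟨hlo, -, hlf, -⟩ := hq
  refine ⟨fun h => ?_, fun h => ?_⟩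
  · obtain rfl := eq_zero_of_mk_eq_rootEdge h
    rw [zero_add] at hlf
    exact hlf (mk_zero_e₁_mem_pedges hχ hn)
  · obtain ⟨m, hm, hqm⟩ := Finset.mem_image.1
      (exists_mem_pedges_iff.1 ⟨_, hlo, Sym2.mem_mk_left _ _⟩)
    have hq1 : 0 ≤ q 1 := by
      rw [← hqm]
      exact apply_one_nonneg_of_mem_lexRooted hχ (Nat.lt_succ_iff.1 (Finset.mem_range.1 hm))
    rw [rootEdge, Sym2.eq_iff] at h
    rcases h with ⟨h, -⟩ | ⟨h, -⟩
    · have h' := congrFun h 1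
      simp only [Pi.add_apply, Pi.zero_apply, e₀_e₁_apply.2.2.2] at h'
      omega
    · have h' := congrFun h 1
      simp only [Pi.add_apply, e₀_e₁_apply.2.1, e₀_e₁_apply.2.2.2] at h'
      omega

/-! ## Hammond's Lemma 4.7: both arcs cross a global join plaquette -/

/-- **Stub `gjoins_arcs` (Hammond's Lemma 4.7, anchor at the root).** For a lex-rooted polygon `P(χ)`
(`n ≥ 3`) and a global join plaquette at `q`, the head arc `χ[0, esIdx]` (root → `ES`) traverses one
of the two horizontal sides `{q, q+e₀}`, `{q+e₁, q+e₀+e₁}` of the plaquette, and so does the tail arc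
`χ[esIdx, n]`. Crossing argument: a step edge other than the two sides survives the flip into
`E₁ ∪ E₂`; an edge of `E₁ ∪ E₂` with an endpoint on `E₁` (resp. `E₂`) keeps its other endpoint there
(vertex-disjointness); the root `0` is on `E₁`, `ES` is on `E₂`, and `χ n = e₀` is on `E₁` since the root
edge survives the flip and contains `0`. [cite: Hammond2015SAPJoining, Lemma 4.7] -/
theorem gjoins_arcs : ∀ (n : ℕ) (χ : ℕ → Site 2), χ ∈ lexRooted n → 3 ≤ n → ∀ q ∈ gjoins n χ, (∃ i : ℕ, i < esIdx n χ ∧ (s(χ i, χ (i + 1)) = s(q, q + e₀) ∨ s(χ i, χ (i + 1)) = s(q + e₁, q + e₀ + e₁))) ∧ (∃ i : ℕ, esIdx n χ ≤ i ∧ i < n ∧ (s(χ i, χ (i + 1)) = s(q, q + e₀) ∨ s(χ i, χ (i + 1)) = s(q + e₁, q + e₀ + e₁))) := by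
  intro n χ hχ hn q hq
  obtain ⟨-, hJ, E₁, E₂, -, -, hdis, hU, h0, hright⟩ := mem_gjoins.1 hq
  have hsaw := lexRooted_subset n hχ
  obtain ⟨hχ0, hend, -, -⟩ := Zd.mem_sawFun.1 hsaw
  obtain ⟨hes_le, hes_eq⟩ := esIdx_spec n χ
  -- an edge of `P(χ)` other than the two horizontal sides survives the flip
  have hflip : ∀ e ∈ pedges n χ, e ≠ s(q, q + e₀) → e ≠ s(q + e₁, q + e₀ + e₁) →
      e ∈ E₁ ∨ e ∈ E₂ := by
    intro e he h₁ h₂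
    rw [← Finset.mem_union, hU, flipH]
    exact Finset.mem_insert_of_mem (Finset.mem_insert_of_mem
      (Finset.mem_erase.2 ⟨h₂, Finset.mem_erase.2 ⟨h₁, he⟩⟩))
  -- side propagation along an edge of `E₁ ∪ E₂`
  have hprop₁ : ∀ a b : Site 2, (s(a, b) ∈ E₁ ∨ s(a, b) ∈ E₂) → (∃ e ∈ E₁, a ∈ e) →
      ∃ e ∈ E₁, b ∈ e := by
    rintro a b (h | h) ha
    · exact ⟨_, h, Sym2.mem_mk_right _ _⟩
    · exact (hdis a ha ⟨_, h, Sym2.mem_mk_left _ _⟩).elim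
  have hprop₂ : ∀ a b : Site 2, (s(a, b) ∈ E₁ ∨ s(a, b) ∈ E₂) → (∃ e ∈ E₂, a ∈ e) →
      ∃ e ∈ E₂, b ∈ e := by
    rintro a b (h | h) ha
    · exact (hdis a ⟨_, h, Sym2.mem_mk_left _ _⟩ ha).elim
    · exact ⟨_, h, Sym2.mem_mk_right _ _⟩
  -- `ES` lies on `E₂`
  have hES : ∃ e ∈ E₂, χ (esIdx n χ) ∈ e := by
    rw [hes_eq]
    exact hright _ (esVertex_mem_rightCol n χ)
  refine ⟨?_, ?_⟩
  · -- head arc `χ[0, esIdx]`: from `0 ∈ E₁` to `ES ∈ E₂`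
    by_contra hcon
    have hcon' : ∀ i, i < esIdx n χ →
        s(χ i, χ (i + 1)) ≠ s(q, q + e₀) ∧ s(χ i, χ (i + 1)) ≠ s(q + e₁, q + e₀ + e₁) :=
      fun i hi => ⟨fun h => hcon ⟨i, hi, Or.inl h⟩, fun h => hcon ⟨i, hi, Or.inr h⟩⟩
    have hind : ∀ i, i ≤ esIdx n χ → ∃ e ∈ E₁, χ i ∈ e := by
      intro i
      induction i with
      | zero =>
        intro
        rw [hχ0]
        exact h0
      | succ i ih =>
        intro hi
        obtain ⟨h₁, h₂⟩ := hcon' i (by omega)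
        exact hprop₁ _ _ (hflip _ (mk_step_mem_pedges χ (by omega)) h₁ h₂) (ih (by omega))
    exact hdis _ (hind _ le_rfl) hES
  · -- tail arc `χ[esIdx, n]`: from `ES ∈ E₂` to `e₀ ∈ E₁`
    by_contra hcon
    have hcon' : ∀ i, esIdx n χ ≤ i → i < n →
        s(χ i, χ (i + 1)) ≠ s(q, q + e₀) ∧ s(χ i, χ (i + 1)) ≠ s(q + e₁, q + e₀ + e₁) :=
      fun i hi hi' => ⟨fun h => hcon ⟨i, hi, hi', Or.inl h⟩, fun h => hcon ⟨i, hi, hi', Or.inr h⟩⟩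
    have hind : ∀ i, esIdx n χ ≤ i → i ≤ n → ∃ e ∈ E₂, χ i ∈ e := by
      intro i hi
      induction i, hi using Nat.le_induction with
      | base => exact fun _ => hES
      | succ i hi ih =>
        intro hi'
        obtain ⟨h₁, h₂⟩ := hcon' i hi (by omega)
        exact hprop₂ _ _ (hflip _ (mk_step_mem_pedges χ (by omega)) h₁ h₂) (ih (by omega))
    have hn' : ∃ e ∈ E₂, e₀ ∈ e := by
      rw [← hend n le_rfl]
      exact hind n hes_le le_rfl
    obtain ⟨hr₁, hr₂⟩ := rootEdge_ne_of_isJoinPlaq n χ hχ (by omega) q hJ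
    rcases hflip _ (rootEdge_mem_pedges_of_mem_sawFun hsaw) hr₁.symm hr₂.symm with h | h
    · exact hdis e₀ ⟨_, h, Sym2.mem_mk_right _ _⟩ hn'
    · exact hdis 0 h0 ⟨_, h, Sym2.mem_mk_left _ _⟩

end Summit.CriticalPhenomena.SAWScalingLimit.Theorems.CriticalBubbleBound.Join

end
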